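import Literature.AnabelianGeometry.EtaleTheta.Discharge.Sec3Cor38iiOfRatSupport
import Literature.AnabelianGeometry.EtaleTheta.Discharge.Sec3Cor38iiToyGenuine
import Literature.AnabelianGeometry.EtaleTheta.Discharge.Sec3Cor38iOfRatSupport
import Literature.AnabelianGeometry.EtaleTheta.TemperedFrobenioidRestrict

/-!
# [EtTh] Corollary 3.8 (i), (ii) AS TYPED hold OUTRIGHT for a constructed tempered Frobenioid over the GENUINE base
# `B^temp(Π)⁰` of every topological group `Π` (non-vacuity of the node closers over print's base category)

Mochizuki, *The étale theta function and its Frobenioid-theoretic manifestations*, Publ. RIMS **45** (2009),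
Cor. 3.8 (i)/(ii), PDF pp. 80–82 [cite: MochizukiEtTh2009, Cor 3.8 p.80]; Def. 3.6 (ii) pp. 76–77 ("Let `D` be a
connected, totally epimorphic category, equipped with a functor `D → D₀`"); S. Mochizuki, *The geometry of Frobenioids
II* (2008), Ex. 1.3 (the connected temperoid `B^temp(Π)⁰` is connected, totally epimorphic, of FSM-type); *Frobenioids I*
Def. 3.1 (i) p.56 (slim ⇒ Frobenius-slim) [cite: MochizukiFrdI2008, Def. 3.1 (i) p.56].
abc-iut cell, layer L2, cone nodes `EtTh:Cor3.8(i)` / `EtTh:Cor3.8(ii)`; seat abc-iut-w6-d040 (gen 2); PROOF-ONLY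
(0 definitions) instantiation witness, sequel of this seat's `Discharge/Sec3Cor38iiToyGenuine.lean` (p437925/p439350) and
of `Discharge/Sec3Cor38iToyGenuine.lean` (abc-iut-w6-d039 p439637 / this seat p439650, tree copy of record w6-d039's),
whose instances live over the ONE-OBJECT base `Discrete PUnit`.

HERE the base is print's `D = B^temp(Π)⁰ = ConnectedPart (BTemp Π)` for an ARBITRARY topological group `Π`:
abc-iut-w6-d048's `Toy.genuineTemperedFrobenioidConnectedPart Π R S` (`TemperedFrobenioidRestrict.lean`, p-landed; the
genuine-vocabulary toy re-based along the constant functor `B^temp(Π)⁰ → D₀`, [FrdI] Prop. 1.6).  At this datum the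
structural clause `hFSM` ("FSM-morphisms of `D` are isomorphisms") is the THEOREM
`QuasiTemperoid.BTempConnected.connectedPart_isOfFSMType` ([FrdII] Ex. 1.3), the remaining clauses of the node closers
(`hB₀inj`, `dm.Prop34`, `hF₀inv`, `hcyc`, `hZQ`, `hsat`) are the toy `D₀`-level facts already in the tree
(abc-iut-w4-d008, w5-d130, this seat), and `Cor38Hyp` is inhabited (`Ψ := 𝟭`; `B^temp(Π)⁰` of FSM-type hence of
FSMFF-type; `Φ` non-dilating along the constant base functor):

* `Toy.genuineTemperedFrobenioidConnectedPart_nonDilating`, `Toy.nonempty_cor38Hyp_genuineConnectedPart`;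
* **`Toy.cor38_ii_genuineConnectedPart (h) : Cor38_ii (Def. 4.5 (iv)) h`** — this seat's `Cor38Hyp.cor38_ii_ofRlfZ_of_structural`
  (p437110) fired over `B^temp(Π)⁰`;
* **`Toy.cor38_i_genuineConnectedPart (h) : Cor38_i (fun E _ => IsFrobeniusSlim E) h`** — abc-iut-w6-d039's
  `Cor38Hyp.cor38_i_ofRlfZ_of_structural` (p438712) fired over `B^temp(Π)⁰`;
* **`Toy.preservesBaseFieldTheoretic_genuineConnectedPart (hG : IsTempered Π) (hZ : IsSlimGroup Π) (h)`** — the CONCLUSION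
  of Cor. 3.8 (i) over the genuine base of a tempered, temp-slim `Π`: `B^temp(Π)⁰` is slim (abc-iut's
  `isSlim_connectedPart_bTemp`, [SemiAnbd] Rmk. 3.1.5 / [FrdII] Ex. 1.3), hence Frobenius-slim ([FrdI] Def. 3.1 (i));
* `∃`-forms `Toy.exists_cor38_ii_genuineConnectedPart`, `Toy.exists_cor38_i_genuineConnectedPart`;
* (v2 append) `isDivSlim45iv_of_isSlim` — "[Thus, if `D` is slim, then it is Div-slim.]" ([FrdI] Def. 4.5 (iv) p.86;
  the (E, Φ)-form of L1's `PreFrobenioidData.isDivSlim_of_isSlim`), the general corollary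
  **`Cor38Hyp.cor38_ii_conclusion_of_isSlim`** (ANY proof of the typed `Cor38_ii` at the Def. 4.5 (iv) parameter + `D₁`,
  `D₂` slim ⇒ the CONCLUSION of Cor. 3.8 (ii): `Ψ` preserves base-field-theoretic morphisms and induces a compatible
  equivalence of the hulls), and **`Toy.cor38_ii_conclusion_genuineConnectedPart (hG) (hZ) (h)`** — the CONCLUSION of
  Cor. 3.8 (ii) over the genuine base of a tempered, temp-slim `Π` (+ `∃`-form).

HONEST LABEL: the base category is print's; the divisor geometry stays DEGENERATE (one prime, `Λ = ℤ`, all functions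
constant, base functor constant) — consistency / instantiation witnesses showing the closers' print-level hypothesis
lists are jointly satisfiable over `B^temp(Π)⁰` and that the compositions fire; NOT the tempered Frobenioid of a curve;
refereed pre-IUT material; nothing here bears on [IUTchIII] Cor. 3.12; no side taken; typed ≠ proved.
-/

noncomputable section

namespace Literature.AnabelianGeometry.EtaleTheta

open CategoryTheory Opposite Function Literature.AlgebraicGeometry.Frobenioids Literature.AnabelianGeometry.SemiGraphs

universe u'

namespace Toy

open Example39NV

variable (Γ : Type u') [Group Γ] [TopologicalSpace Γ]
  (R S : ((ConnectedPart (BTemp Γ))ᵒᵖ ⥤ CommMonCat.{0}) → Prop)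

/-- `Φ` of the re-based toy is non-dilating under every endomorphism of a base object: its pull-backs are pull-backs
of the one-object toy along identities. [cite: MochizukiEtTh2009, Cor 3.8 p.80] -/
theorem genuineTemperedFrobenioidConnectedPart_nonDilating (A : (ConnectedPart (BTemp Γ))ᵒᵖ) (f : A ⟶ A) :
    treeMonoidVocab.IsNonDilating _ ((genuineTemperedFrobenioidConnectedPart Γ R S).Φ.pull f) :=
  genuineTemperedFrobenioid_nonDilating (fun _ => True) (fun _ => True) (op (Discrete.mk PUnit.unit)) (𝟙 _)

/-- **`Cor38Hyp` is inhabited over the genuine base `B^temp(Π)⁰`** (`C₁ = C₂ :=` the re-based toy, `Ψ := 𝟭`):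
`B^temp(Π)⁰` is of FSM-type ([FrdII] Ex. 1.3) hence of FSMFF-type, and `Φ` is non-dilating.
[cite: MochizukiEtTh2009, Cor 3.8 p.80] -/
theorem nonempty_cor38Hyp_genuineConnectedPart :
    Nonempty (Cor38Hyp (genuineTemperedFrobenioidConnectedPart Γ R S)
      (genuineTemperedFrobenioidConnectedPart Γ R S)) :=
  ⟨{ Ψ := CategoryTheory.Equivalence.refl
     fsmff := ⟨QuasiTemperoid.BTempConnected.connectedPart_isOfFSMType.isOfFSMFFType,
       QuasiTemperoid.BTempConnected.connectedPart_isOfFSMType.isOfFSMFFType⟩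
     nonDilating := ⟨genuineTemperedFrobenioidConnectedPart_nonDilating Γ R S,
       genuineTemperedFrobenioidConnectedPart_nonDilating Γ R S⟩ }⟩

/-- **[EtTh] Cor. 3.8 (ii) AS TYPED holds OUTRIGHT over the genuine base `B^temp(Π)⁰`**, for every topological group `Π`
and every inhabitant `h` of the standing hypotheses on the re-based toy: this seat's
`Cor38Hyp.cor38_ii_ofRlfZ_of_structural` (p437110) with `hFSM` := [FrdII] Ex. 1.3 (`connectedPart_isOfFSMType`) and the
toy `D₀`-level clauses `hB₀inj`, `Prop34`, `hF₀inv`, `hcyc`, `hZQ`, `hsat`. [cite: MochizukiEtTh2009, Cor 3.8 p.81] -/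
theorem cor38_ii_genuineConnectedPart
    (h : Cor38Hyp (genuineTemperedFrobenioidConnectedPart Γ R S) (genuineTemperedFrobenioidConnectedPart Γ R S)) :
    Literature.AnabelianGeometry.EtaleTheta.Cor38_ii
      (fun E _ Φ => ∀ (A : E) (α : Aut (Over.forget A)),
        (∀ (B : Over A) (x : Φ.obj (op B.left)),
          Literature.AlgebraicGeometry.Frobenioids.pull Φ (α.hom.app B) x = x) → α = 1) h :=
  h.cor38_ii_ofRlfZ_of_structural (fun g => hB₀inj_divisorMonoids g)
    (fun α hα => QuasiTemperoid.BTempConnected.connectedPart_isOfFSMType.isIso_of_isFSM α hα)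
    prop34_divisorMonoids hF₀inv_divisorMonoids cnstCyclic_divisorMonoids (fun _ 𝔭 => isZQMonoprime_primes_Φ₀ _ 𝔭)
    (fun _ => ratSupport_genuine (fun _ => True) (fun _ => True) _) (fun g => hB₀inj_divisorMonoids g)
    (fun α hα => QuasiTemperoid.BTempConnected.connectedPart_isOfFSMType.isIso_of_isFSM α hα)
    prop34_divisorMonoids hF₀inv_divisorMonoids cnstCyclic_divisorMonoids (fun _ 𝔭 => isZQMonoprime_primes_Φ₀ _ 𝔭)
    (fun _ => ratSupport_genuine (fun _ => True) (fun _ => True) _)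

/-- **[EtTh] Cor. 3.8 (i) AS TYPED holds OUTRIGHT over the genuine base `B^temp(Π)⁰`**: abc-iut-w6-d039's
`Cor38Hyp.cor38_i_ofRlfZ_of_structural` (p438712) with the same clauses. [cite: MochizukiEtTh2009, Cor 3.8 p.80] -/
theorem cor38_i_genuineConnectedPart
    (h : Cor38Hyp (genuineTemperedFrobenioidConnectedPart Γ R S) (genuineTemperedFrobenioidConnectedPart Γ R S)) :
    Literature.AnabelianGeometry.EtaleTheta.Cor38_i
      (fun E _ => Literature.AlgebraicGeometry.Frobenioids.IsFrobeniusSlim E) h :=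
  h.cor38_i_ofRlfZ_of_structural (fun g => hB₀inj_divisorMonoids g)
    (fun α hα => QuasiTemperoid.BTempConnected.connectedPart_isOfFSMType.isIso_of_isFSM α hα)
    prop34_divisorMonoids cnstCyclic_divisorMonoids (fun _ 𝔭 => isZQMonoprime_primes_Φ₀ _ 𝔭)
    (fun _ => ratSupport_genuine (fun _ => True) (fun _ => True) _) (fun g => hB₀inj_divisorMonoids g)
    (fun α hα => QuasiTemperoid.BTempConnected.connectedPart_isOfFSMType.isIso_of_isFSM α hα)
    prop34_divisorMonoids cnstCyclic_divisorMonoids (fun _ 𝔭 => isZQMonoprime_primes_Φ₀ _ 𝔭)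
    (fun _ => ratSupport_genuine (fun _ => True) (fun _ => True) _)

variable [IsTopologicalGroup Γ]

/-- **The CONCLUSION of [EtTh] Cor. 3.8 (i) over the genuine base of a tempered, temp-slim group `Π`**: every `Ψ` in a
`Cor38Hyp` of the re-based toy preserves the base-field-theoretic morphisms — `B^temp(Π)⁰` is slim
(`isSlim_connectedPart_bTemp`), hence Frobenius-slim ([FrdI] Def. 3.1 (i), `IsSlim.isFrobeniusSlim`).
[cite: MochizukiEtTh2009, Cor 3.8 p.80] -/
theorem preservesBaseFieldTheoretic_genuineConnectedPart (hG : IsTempered Γ) (hZ : IsSlimGroup Γ)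
    (h : Cor38Hyp (genuineTemperedFrobenioidConnectedPart Γ R S) (genuineTemperedFrobenioidConnectedPart Γ R S)) :
    PreservesBaseFieldTheoretic h :=
  cor38_i_genuineConnectedPart Γ R S h (isSlim_connectedPart_bTemp hG hZ).isFrobeniusSlim
    (isSlim_connectedPart_bTemp hG hZ).isFrobeniusSlim

omit [IsTopologicalGroup Γ] in
/-- `∃`-form for the node `EtTh:Cor3.8(ii)` over the genuine base: with `Ψ := 𝟭`.
[cite: MochizukiEtTh2009, Cor 3.8 p.81] -/
theorem exists_cor38_ii_genuineConnectedPart :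
    ∃ h : Cor38Hyp (genuineTemperedFrobenioidConnectedPart Γ R S) (genuineTemperedFrobenioidConnectedPart Γ R S),
      Literature.AnabelianGeometry.EtaleTheta.Cor38_ii
        (fun E _ Φ => ∀ (A : E) (α : Aut (Over.forget A)),
          (∀ (B : Over A) (x : Φ.obj (op B.left)),
            Literature.AlgebraicGeometry.Frobenioids.pull Φ (α.hom.app B) x = x) → α = 1) h := by
  obtain ⟨h⟩ := nonempty_cor38Hyp_genuineConnectedPart Γ R S
  exact ⟨h, cor38_ii_genuineConnectedPart Γ R S h⟩

/-- `∃`-form for the node `EtTh:Cor3.8(i)` over the genuine base of a tempered, temp-slim `Π`: the typed statement AND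
its conclusion, with `Ψ := 𝟭`. [cite: MochizukiEtTh2009, Cor 3.8 p.80] -/
theorem exists_cor38_i_genuineConnectedPart (hG : IsTempered Γ) (hZ : IsSlimGroup Γ) :
    ∃ h : Cor38Hyp (genuineTemperedFrobenioidConnectedPart Γ R S) (genuineTemperedFrobenioidConnectedPart Γ R S),
      Literature.AnabelianGeometry.EtaleTheta.Cor38_i
          (fun E _ => Literature.AlgebraicGeometry.Frobenioids.IsFrobeniusSlim E) h ∧
        PreservesBaseFieldTheoretic h := by
  obtain ⟨h⟩ := nonempty_cor38Hyp_genuineConnectedPart Γ R S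
  exact ⟨h, cor38_i_genuineConnectedPart Γ R S h, preservesBaseFieldTheoretic_genuineConnectedPart Γ R S hG hZ h⟩

/-! ### v2 (append): slim bases are Div-slim ([FrdI] Def. 4.5 (iv) p.86), so the CONCLUSION of Cor. 3.8 (ii) follows -/

end Toy

section SlimConclusion

universe u₀ v₀ u v w

/-- **"[Thus, if `D` is slim, then it is Div-slim.]"** ([FrdI] Def. 4.5 (iv), p.86) in the `(E, Φ)`-form used as the
vocabulary parameter of the Cor. 3.8 (ii) node closers: for a slim category `E` and ANY monoid `Φ` on it, an
automorphism of `E_A → E` (acting trivially on `Φ` or not) is trivial.  (L1's `PreFrobenioidData.isDivSlim_of_isSlim` is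
the same fact for the operations form.) [cite: MochizukiFrdI2008, Def. 4.5 (iv) p.86] -/
theorem isDivSlim45iv_of_isSlim {E : Type u} [Category.{v} E] (hE : IsSlim E) (Φ : Eᵒᵖ ⥤ CommMonCat.{w}) :
    ∀ (A : E) (α : Aut (Over.forget A)),
      (∀ (B : Over A) (x : Φ.obj (op B.left)),
        Literature.AlgebraicGeometry.Frobenioids.pull Φ (α.hom.app B) x = x) → α = 1 :=
  fun A α _ => by
    have := hE.isRigid_forget A α
    rw [this]; rfl

variable {D₀ : Type u₀} [Category.{v₀} D₀] {V : FrdIMonoidStub.{w}}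
  {T : RealifiedDivisorMonoids (D₀ := D₀) V} {D : Type u} [Category.{v} D] {VD : FrdICatStub.{u, v, w} D}
  {D₀' : Type u₀} [Category.{v₀} D₀'] {T' : RealifiedDivisorMonoids (D₀ := D₀') V}
  {D' : Type u} [Category.{v} D'] {VD' : FrdICatStub.{u, v, w} D'}
  {C₁ : TemperedFrobenioid T D VD} {C₂ : TemperedFrobenioid T' D' VD'}

/-- **The CONCLUSION of [EtTh] Cor. 3.8 (ii) over SLIM bases**, from ANY proof of abc-iut-L2-t3's typed `Cor38_ii` at the
[FrdI] Def. 4.5 (iv) parameter (every node closer of `Sec3Cor38iiOfRatSupport` / `Sec3Cor38Cor411ii` / … concludes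
exactly this): if `D₁`, `D₂` are slim ([FrdI] §0; e.g. `B^temp(Π)⁰` for `Π` tempered and temp-slim,
`isSlim_connectedPart_bTemp`) then `Ψ` preserves the base-field-theoretic morphisms and induces a compatible equivalence
`C₁^{bs-fld} ≌ C₂^{bs-fld}`. [cite: MochizukiEtTh2009, Cor 3.8 p.81] -/
theorem Cor38Hyp.cor38_ii_conclusion_of_isSlim (h : Cor38Hyp C₁ C₂)
    (H : Literature.AnabelianGeometry.EtaleTheta.Cor38_ii
      (fun E _ Φ => ∀ (A : E) (α : Aut (Over.forget A)),
        (∀ (B : Over A) (x : Φ.obj (op B.left)),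
          Literature.AlgebraicGeometry.Frobenioids.pull Φ (α.hom.app B) x = x) → α = 1) h)
    (h₁ : IsSlim D) (h₂ : IsSlim D') :
    PreservesBaseFieldTheoretic h ∧
      ∃ Ψbs : C₁.hullCategory ≌ C₂.hullCategory, Nonempty (C₁.hull ⋙ h.Ψ.functor ≅ Ψbs.functor ⋙ C₂.hull) :=
  H (isDivSlim45iv_of_isSlim h₁ _) (isDivSlim45iv_of_isSlim h₂ _)

end SlimConclusion

namespace Toy

variable (Γ : Type u') [Group Γ] [TopologicalSpace Γ] [IsTopologicalGroup Γ]
  (R S : ((ConnectedPart (BTemp Γ))ᵒᵖ ⥤ CommMonCat.{0}) → Prop)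

/-- **The CONCLUSION of [EtTh] Cor. 3.8 (ii) over the genuine base of a tempered, temp-slim group `Π`**: every `Ψ` in a
`Cor38Hyp` of the re-based toy preserves the base-field-theoretic morphisms AND induces a compatible self-equivalence of
the hull `C^{bs-fld}` — `B^temp(Π)⁰` is slim (`isSlim_connectedPart_bTemp`), hence Div-slim ([FrdI] Def. 4.5 (iv)).
[cite: MochizukiEtTh2009, Cor 3.8 p.81] -/
theorem cor38_ii_conclusion_genuineConnectedPart (hG : IsTempered Γ) (hZ : IsSlimGroup Γ)
    (h : Cor38Hyp (genuineTemperedFrobenioidConnectedPart Γ R S) (genuineTemperedFrobenioidConnectedPart Γ R S)) :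
    PreservesBaseFieldTheoretic h ∧
      ∃ Ψbs : (genuineTemperedFrobenioidConnectedPart Γ R S).hullCategory ≌
          (genuineTemperedFrobenioidConnectedPart Γ R S).hullCategory,
        Nonempty ((genuineTemperedFrobenioidConnectedPart Γ R S).hull ⋙ h.Ψ.functor ≅
          Ψbs.functor ⋙ (genuineTemperedFrobenioidConnectedPart Γ R S).hull) :=
  h.cor38_ii_conclusion_of_isSlim (cor38_ii_genuineConnectedPart Γ R S h) (isSlim_connectedPart_bTemp hG hZ)
    (isSlim_connectedPart_bTemp hG hZ)

/-- `∃`-form: over the genuine base of a tempered, temp-slim `Π` the typed statement of the node `EtTh:Cor3.8(ii)` AND its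
conclusion have unconditional kernel instances (`Ψ := 𝟭`). [cite: MochizukiEtTh2009, Cor 3.8 p.81] -/
theorem exists_cor38_ii_conclusion_genuineConnectedPart (hG : IsTempered Γ) (hZ : IsSlimGroup Γ) :
    ∃ h : Cor38Hyp (genuineTemperedFrobenioidConnectedPart Γ R S) (genuineTemperedFrobenioidConnectedPart Γ R S),
      PreservesBaseFieldTheoretic h ∧
        ∃ Ψbs : (genuineTemperedFrobenioidConnectedPart Γ R S).hullCategory ≌
            (genuineTemperedFrobenioidConnectedPart Γ R S).hullCategory,
          Nonempty ((genuineTemperedFrobenioidConnectedPart Γ R S).hull ⋙ h.Ψ.functor ≅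
            Ψbs.functor ⋙ (genuineTemperedFrobenioidConnectedPart Γ R S).hull) := by
  obtain ⟨h⟩ := nonempty_cor38Hyp_genuineConnectedPart Γ R S
  exact ⟨h, cor38_ii_conclusion_genuineConnectedPart Γ R S hG hZ h⟩

end Toy

end Literature.AnabelianGeometry.EtaleTheta

end
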